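import Summits.CriticalPhenomena.PercolationContinuityZ3.Theorems.Transplant.SkelPhiNegReachReadCK
import Summits.CriticalPhenomena.PercolationContinuityZ3.Theorems.Transplant.SkelPhiNegReachRecsK
import Summits.CriticalPhenomena.PercolationContinuityZ3.Theorems.Transplant.SkelPhiNegReachRoomsC
import HarnessLib

/-!
# N1 (the `{±1}` node), (C) column under (ζ′) — file (C-S9e-K): THE ROOMS OF THE WINDOWED y′-BAND OF `800·kq` STRIDES (the twin of
# `SkelPhiNegReachRoomsCy` (C-S9e, p301491) with the box multiplier `kq`; NEG-SCOPE §B.19 (ζ′)): the y′-band `yPrmXw n ℓ h v T q_y (800kq − 1) Wmy Wpy`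
# read in `runX φ c₀ n h 1` with the corridor sign `σ = sgOf du` (along axis `1 = ⌊β′/U⌋`, across axis `0`, drifting by `v` per stride):
# (§1) the anchor mismatch of `j ≤ 800kq` v-strides `|Δ·(σj) − U·(σj·W_B)| ≤ 800kq·(n + U)` and the corner values; (§2) **every region
# `j ≤ 800kq − 1` reads inside the rooms** from three BAND FLOORS `hby1` (`U·(q_y + 800kq·T + La + 1) + 2Δ ≤ 200kq·Δ`), `hby2`
# (`U·((800kq−1)·W_B + q_y + 800kq·T + La + 1) + 2Δ ≤ 880kq·Δ`), `hby3` (the drifting-box budget across with `B := Wmy + Wpy + 800kq·T + n`,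
# `ρ := 2400kq − 3 + q_y + 800kq·T + La`, `E := 800kq·(n + U)`, `Y := 2r₀`); (§3) **the last core (`j = 800kq`) reads inside the next cell's
# arrival box `cen' ± (b₀ − 1)`** from the TARGET FLOORS `hyL1`/`hyL2` (along) and `hyL3` (across: `B := Wmy + Wpy + 800kq·T`, `ρ := 2400kq + q_y +
# 800kq·T`, `E := 800kq·(n + U)`, `Y := b₀⊥`) — the twin of `SkelPhiNegReachRoomsCyL` §3 (C-S9f, p301872). Commensurability `c_i'·A·(40kq·Δ) = r_i·D`,
# `40kq ≤ r_i`. The habitat points of both bands and the assembly by corridor axis: (C-S9g-K) `SkelPhiNegReachRoomsCK`. The case `kq = 1` is the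
# record (C-S9e/f).

builds on p205010 (kernel theorem, internal audit signed; external expert review pending) — nothing in this file uses p205010; nothing here is a
claim about the open node `SamePDropOfSkeletonNeg₁`.
Lane `prim-bschramm`, seat `prim-bschramm-p5` (gen 11; (C) lineage); helper file (`--supports stmt-CriticalPhenomena-4575`).
[cite: KozmaNitzan2024, §4 Lemma 11 (p. 22), Lemma 12 (pp. 23–25), p. 26 (M_v, H_{v,x})] [cite: MartineauTassion2017, §4.3 Lemma 4.2]
-/

noncomputable section

namespace Summit.CriticalPhenomena.PercolationContinuityZ3.Theorems

namespace Transplant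

namespace Skelφ

namespace CorrRec

open Literature.Probability.Percolation Literature.Probability.LatticeModels
open Literature.Probability.Percolation.KozmaNitzan.Cells (oth oth_ne sgOf sgOf_sign eq_oth_of_ne)
open TwoAxis.Para (modulus)
open ChainPlanar ChainPara

/-- `oth 1 = 0` on `Fin 2`. [folklore] -/
private theorem oth_one' : oth (1 : Fin 2) = 0 := by decide

/-! ## §1 The anchor mismatch and the corners -/

/-- **The anchor mismatch of `j ≤ 800kq` v-strides**: `|Δ·(σj) − U·(σj·W_B)| ≤ 800kq·(n + U)` when `nℓ − n < Δ ≤ nℓ`. [folklore] -/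
theorem anchor_leK {n : ℕ} (hn : 1 ≤ n) (ℓ : ℕ) {h v vβ : ℤ} (hΔlo : (n : ℤ) * ℓ - n < modulus n h v vβ) (hΔhi : modulus n h v vβ ≤ (n : ℤ) * ℓ)
    {kq : ℕ} (hkq : 1 ≤ kq) {σ : ℤ} (hσ : σ = 1 ∨ σ = -1) {j : ℕ} (hj : j ≤ 800 * kq) :
    |modulus n h v vβ * (σ * j) - (shearUnit n h : ℤ) * (σ * j * (Qw n ℓ h : ℕ))| ≤ 800 * (kq : ℤ) * (n + (shearUnit n h : ℤ)) := by
  obtain ⟨u1, u2⟩ := UQw_bounds hn ℓ h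
  have _hk := hkq
  have hj' : (j : ℤ) ≤ 800 * (kq : ℤ) := by exact_mod_cast hj
  have hj0 : (0 : ℤ) ≤ j := by positivity
  have hσ1 : |σ| = 1 := by rcases hσ with rfl | rfl <;> simp
  have e : modulus n h v vβ * (σ * j) - (shearUnit n h : ℤ) * (σ * j * (Qw n ℓ h : ℕ)) =
      σ * ((j : ℤ) * (modulus n h v vβ - (shearUnit n h : ℤ) * (Qw n ℓ h : ℕ))) := by ring
  rw [e, abs_mul, hσ1, one_mul, abs_mul, abs_of_nonneg hj0]
  have hd : |modulus n h v vβ - (shearUnit n h : ℤ) * (Qw n ℓ h : ℕ)| ≤ n + (shearUnit n h : ℤ) := by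
    rw [abs_le]; constructor <;> linarith
  calc (j : ℤ) * |modulus n h v vβ - (shearUnit n h : ℤ) * (Qw n ℓ h : ℕ)| ≤ (j : ℤ) * (n + (shearUnit n h : ℤ)) :=
        mul_le_mul_of_nonneg_left hd hj0
    _ ≤ 800 * (kq : ℤ) * (n + (shearUnit n h : ℤ)) := mul_le_mul_of_nonneg_right hj' (by positivity)

section YBand

variable {kq : ℕ} {A : ℤ} {n : ℕ} {h v vβ c₀' c₁' D : ℤ} {P : PCells2} {ℓ T : ℕ} {aW bL : ℤ}

/-- The y′-band record of the corridor along a v-direction `du` (`du.1 = 1`). [folklore] -/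
theorem bandNw_yK {du : MDir} (hd : du.1 = 1) :
    bandNw n ℓ h v T n (800 * kq - 1) (qy n ℓ h v T aW bL) (800 * kq - 1) (qy n ℓ h v T aW bL) (Wmy n v) (Wpy n v) du =
      yPrmXw n ℓ h v T (qy n ℓ h v T aW bL) (800 * kq - 1) (Wmy n v) (Wpy n v) := by
  have h10 : ¬ ((1 : Fin 2) = 0) := by decide
  simp [bandNw, hd, h10]

/-- **The corner values of the y′-band record** at step `j`. [folklore] -/
theorem cornersYK (j : ℕ) :
    let R := yPrmXw n ℓ h v T (qy n ℓ h v T aW bL) (800 * kq - 1) (Wmy n v) (Wpy n v)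
    R.aLo j = (j : ℤ) * sA n ℓ h - (qy n ℓ h v T aW bL : ℕ) - j * T ∧ R.aHi j = (j : ℤ) * ((n : ℤ) * ℓ / (shearUnit n h : ℕ) + 1) + (qy n ℓ h v T aW bL : ℕ) + j * T ∧
      R.bLo j = (j : ℤ) * v - ((Wmy n v : ℕ) + (j : ℤ) * T) ∧ R.bHi j = (j : ℤ) * v + ((Wpy n v : ℕ) + (j : ℤ) * T) ∧
      (R.ea : ℤ) = T ∧ (R.eb : ℤ) = T ∧ (R.La : ℤ) = ((3 * (n * ℓ) / shearUnit n h + 1 : ℕ) : ℤ) ∧ (R.Lb : ℤ) = n ∧ R.N = 800 * kq - 1 :=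
  ⟨rfl, rfl, rfl, rfl, rfl, rfl, rfl, rfl, rfl⟩

/-! ## §2 The regions of the y′-band -/

set_option maxHeartbeats 400000 in
/-- **Every region of the y′-band reads inside the rooms with one unit of margin**, either corridor sign, under the three band floors `hby1`
(`U·(q_y + 800kq·T + La + 1) + 2Δ ≤ 200kq·Δ`), `hby2` (`U·((800kq−1)·W_B + q_y + 800kq·T + La + 1) + 2Δ ≤ 880kq·Δ`), `hby3` (the drifting-box budget
across with `B := Wmy + Wpy + 800kq·T + n`, `ρ := 2400kq − 3 + q_y + 800kq·T + La`, `E := 800kq·(n + U)`, `Y := 2r₀`).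
[cite: KozmaNitzan2024, §4 Lemma 11 (p. 22), Lemma 12] -/
theorem roomsByK (hn : 1 ≤ n) (hA : 0 < A) (hD : 0 < D) (hm : 0 < modulus n h v vβ) (hc₀ : 0 < c₀') (hkq : 1 ≤ kq)
    (hsc0 : c₀' * A * (40 * (kq : ℤ) * modulus n h v vβ) = (P.r 0 : ℤ) * D) (hsc1 : c₁' * A * (40 * (kq : ℤ) * modulus n h v vβ) = (P.r 1 : ℤ) * D)
    (hr40 : ∀ i, 40 * (kq : ℤ) ≤ (P.r i : ℤ))
    (hΔlo : (n : ℤ) * ℓ - n < modulus n h v vβ) (hΔhi : modulus n h v vβ ≤ (n : ℤ) * ℓ) (hsT : (T : ℤ) + 1 ≤ sA n ℓ h)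
    (hby1 : (shearUnit n h : ℤ) * (((qy n ℓ h v T aW bL : ℕ) : ℤ) + 800 * (kq : ℤ) * T + (3 * (n * ℓ) / shearUnit n h + 1 : ℕ) + 1) + 2 * modulus n h v vβ ≤
      40 * (kq : ℤ) * 5 * modulus n h v vβ)
    (hby2 : (shearUnit n h : ℤ) * ((800 * (kq : ℤ) - 1) * ((Qw n ℓ h : ℕ) : ℤ) + (qy n ℓ h v T aW bL : ℕ) + 800 * (kq : ℤ) * T + (3 * (n * ℓ) / shearUnit n h + 1 : ℕ) + 1) +
      2 * modulus n h v vβ ≤ 40 * (kq : ℤ) * 22 * modulus n h v vβ)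
    (hby3 : (P.r 0 : ℤ) * (modulus n h v vβ * (((Wmy n v : ℕ) : ℤ) + (Wpy n v : ℕ) + 800 * (kq : ℤ) * T + n) +
        |v| * ((shearUnit n h : ℤ) * ((2400 * (kq : ℤ) - 3 + ((qy n ℓ h v T aW bL : ℕ) : ℤ) + 800 * (kq : ℤ) * T + (3 * (n * ℓ) / shearUnit n h + 1 : ℕ)) + 1)) +
        |v| * (800 * (kq : ℤ) * (n + (shearUnit n h : ℤ)))) + 40 * (kq : ℤ) * modulus n h v vβ * n + (P.r 0 : ℤ) * n ≤ 40 * (kq : ℤ) * modulus n h v vβ * (n * (2 * (P.r 0 : ℤ))))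
    {du : MDir} (hd : du.1 = 1) {j : ℕ} (hj : j ≤ 800 * kq - 1) :
    let Bd := bandNw n ℓ h v T n (800 * kq - 1) (qy n ℓ h v T aW bL) (800 * kq - 1) (qy n ℓ h v T aW bL) (Wmy n v) (Wpy n v) du
    let lo := dLo du.1 (sgOf du) 0 (Bd.aLo j - Bd.ea - Bd.La) (Bd.aHi j + Bd.ea + Bd.La) (Bd.bLo j - Bd.eb - Bd.Lb) (Bd.bHi j + Bd.eb + Bd.Lb)
    let hi := dHi du.1 (sgOf du) 0 (Bd.aLo j - Bd.ea - Bd.La) (Bd.aHi j + Bd.ea + Bd.La) (Bd.bLo j - Bd.eb - Bd.Lb) (Bd.bHi j + Bd.eb + Bd.Lb)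
    (sgOf du = 1 → -(5 * (P.r du.1 : ℤ)) + 1 ≤ rdLo A n h v vβ c₀' c₁' D lo hi du.1 ∧ rdHi A n h v vβ c₀' c₁' D lo hi du.1 ≤ 22 * (P.r du.1 : ℤ) - 1) ∧
    (sgOf du = -1 → -(5 * (P.r du.1 : ℤ)) + 1 ≤ -rdHi A n h v vβ c₀' c₁' D lo hi du.1 ∧ -rdLo A n h v vβ c₀' c₁' D lo hi du.1 ≤ 22 * (P.r du.1 : ℤ) - 1) ∧
    (-(2 * (P.r (oth du.1) : ℤ)) + 1 ≤ rdLo A n h v vβ c₀' c₁' D lo hi (oth du.1) ∧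
      rdHi A n h v vβ c₀' c₁' D lo hi (oth du.1) ≤ 2 * (P.r (oth du.1) : ℤ) - 1) := by
  intro Bd lo hi
  dsimp only [Bd, lo, hi]
  rw [bandNw_yK (n := n) (ℓ := ℓ) (h := h) (v := v) (T := T) (aW := aW) (bL := bL) hd, hd, oth_one']
  obtain ⟨haLo, haHi, hbLo, hbHi, hea, heb, hLa, hLb, -⟩ := cornersYK (n := n) (h := h) (v := v) (ℓ := ℓ) (T := T) (aW := aW) (bL := bL) j
  set R := yPrmXw n ℓ h v T (qy n ℓ h v T aW bL) (800 * kq - 1) (Wmy n v) (Wpy n v) with hR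
  have hQ : ((Qw n ℓ h : ℕ) : ℤ) = (n : ℤ) * ℓ / (shearUnit n h : ℕ) + 1 := by unfold Qw; push_cast; rfl
  rw [← hQ] at haHi
  obtain ⟨hs1, hs2⟩ := sA_bounds hn ℓ h
  set Q : ℤ := ((Qw n ℓ h : ℕ) : ℤ) with hQdef
  set La : ℤ := ((3 * (n * ℓ) / shearUnit n h + 1 : ℕ) : ℤ) with hLadef
  set qY : ℤ := ((qy n ℓ h v T aW bL : ℕ) : ℤ) with hqY
  set Bm : ℤ := qY + 800 * (kq : ℤ) * T + La with hBm
  set Bp : ℤ := (800 * (kq : ℤ) - 1) * Q + qY + 800 * (kq : ℤ) * T + La with hBp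
  set B0 : ℤ := ((Wmy n v : ℕ) : ℤ) + (Wpy n v : ℕ) + 800 * (kq : ℤ) * T + n with hB0
  set ρ : ℤ := 2400 * (kq : ℤ) - 3 + qY + 800 * (kq : ℤ) * T + La with hρ
  have hj' : (j : ℤ) ≤ 800 * (kq : ℤ) - 1 := by have := NCk_spec hkq; omega
  have hj0 : (0 : ℤ) ≤ j := by positivity
  have hT0 : (0 : ℤ) ≤ T := by positivity
  have hn0 : (0 : ℤ) ≤ n := by positivity
  have hq0 : (0 : ℤ) ≤ qY := by positivity
  have hLa0 : (0 : ℤ) ≤ La := by positivity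
  have hQ0 : (0 : ℤ) ≤ Q := by positivity
  have hWm0 : (0 : ℤ) ≤ ((Wmy n v : ℕ) : ℤ) := by positivity
  have hWp0 : (0 : ℤ) ≤ ((Wpy n v : ℕ) : ℤ) := by positivity
  have hsA0 : (0 : ℤ) ≤ sA n ℓ h := by linarith
  have hjT : (j : ℤ) * T ≤ (800 * (kq : ℤ) - 1) * T := mul_le_mul_of_nonneg_right hj' hT0
  have hjT0 : 0 ≤ (j : ℤ) * T := by positivity
  have hjQ : (j : ℤ) * Q ≤ (800 * (kq : ℤ) - 1) * Q := mul_le_mul_of_nonneg_right hj' hQ0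
  have hjs0 : 0 ≤ (j : ℤ) * sA n ℓ h := by positivity
  have hk1 : (0 : ℤ) ≤ 800 * (kq : ℤ) - 1 := by
    have : (1 : ℤ) ≤ kq := by exact_mod_cast hkq
    linarith
  have hjd : 0 ≤ (j : ℤ) * (Q - sA n ℓ h) ∧ (j : ℤ) * (Q - sA n ℓ h) ≤ (800 * (kq : ℤ) - 1) * 3 :=
    ⟨mul_nonneg hj0 (by linarith), mul_le_mul hj' (by linarith) (by linarith) hk1⟩
  -- the along corners
  have cLo : -Bm ≤ R.aLo j - R.ea - R.La := by rw [haLo, hea, hLa]; linarith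
  have cHi : R.aHi j + R.ea + R.La ≤ Bp := by rw [haHi, hea, hLa]; linarith
  -- the along corners about the anchor `j·W_B`
  have dLo' : |R.aLo j - R.ea - R.La - (j : ℤ) * Q| ≤ ρ := by
    rw [haLo, hea, hLa, abs_le]
    have e : (j : ℤ) * sA n ℓ h - qY - j * T - T - La - j * Q = -((j : ℤ) * (Q - sA n ℓ h)) - qY - j * T - T - La := by ring
    rw [e]; constructor <;> linarith [hjd.1, hjd.2]
  have dHi' : |R.aHi j + R.ea + R.La - (j : ℤ) * Q| ≤ ρ := by
    rw [haHi, hea, hLa, abs_le]; constructor <;> linarith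
  -- the across corners: `v·j ∓ B0`
  have eLo : v * j - B0 ≤ R.bLo j - R.eb - R.Lb := by rw [hbLo, heb, hLb]; linarith
  have eHi : R.bHi j + R.eb + R.Lb ≤ v * j + B0 := by rw [hbHi, heb, hLb]; linarith
  have hU0 : (0 : ℤ) ≤ (shearUnit n h : ℤ) := by positivity
  have hby1' : (shearUnit n h : ℤ) * Bm + 2 * modulus n h v vβ ≤ 40 * (kq : ℤ) * 5 * modulus n h v vβ := by
    have : (shearUnit n h : ℤ) * Bm ≤ (shearUnit n h : ℤ) * (Bm + 1) := mul_le_mul_of_nonneg_left (by linarith) hU0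
    linarith [hby1]
  have hby2' : (shearUnit n h : ℤ) * Bp + 2 * modulus n h v vβ ≤ 40 * (kq : ℤ) * 22 * modulus n h v vβ := by
    have : (shearUnit n h : ℤ) * Bp ≤ (shearUnit n h : ℤ) * (Bp + 1) := mul_le_mul_of_nonneg_left (by linarith) hU0
    linarith [hby2]
  have hj8 : j ≤ 800 * kq := by omega
  rcases sgOf_sign du with hs | hs <;> rw [hs]
  · obtain ⟨e1, e0, e1', e0'⟩ := dLoHi_one_zero 1 (R.aLo j - R.ea - R.La) (R.aHi j + R.ea + R.La) (R.bLo j - R.eb - R.Lb) (R.bHi j + R.eb + R.Lb)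
    rw [oth_one'] at e0 e0'
    set lo' := dLo 1 1 0 (R.aLo j - R.ea - R.La) (R.aHi j + R.ea + R.La) (R.bLo j - R.eb - R.Lb) (R.bHi j + R.eb + R.Lb) with hlo'
    set hi' := dHi 1 1 0 (R.aLo j - R.ea - R.La) (R.aHi j + R.ea + R.La) (R.bLo j - R.eb - R.Lb) (R.bHi j + R.eb + R.Lb) with hhi'
    have k1 := readLo1_of_budgetK (A := A) (c₀' := c₀') (D := D) hD hm hkq hsc1 hr40 (lo := lo') (hi := hi') (m := 5) (B := Bm) (by rw [e1]; exact cLo) hby1'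
    have k2 := readHi1_of_budgetK (A := A) (c₀' := c₀') (D := D) hD hm hkq hsc1 hr40 (lo := lo') (hi := hi') (m := 22) (B := Bp) (by rw [e1']; exact cHi) hby2
    have hanch := anchor_leK hn ℓ hΔlo hΔhi hkq (Or.inl rfl : (1 : ℤ) = 1 ∨ (1 : ℤ) = -1) hj8
    have k3 := readAcross0_driftK (c₁' := c₁') hn hA hD hm hc₀ hkq hsc0 (lo := lo') (hi := hi') (t := 1 * j) (B := B0) (c := 1 * j * Q) (ρ := ρ)
      (E := 800 * (kq : ℤ) * (n + (shearUnit n h : ℤ))) (Y := 2 * (P.r 0 : ℤ))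
      (by rw [e0]; linarith) (by rw [e0']; linarith) (by rw [e1, one_mul]; exact dLo') (by rw [e1', one_mul]; exact dHi') hanch hby3
    exact ⟨fun _ => ⟨by linarith only [k1], by linarith only [k2]⟩, fun h1 => absurd h1 (by norm_num), by linarith only [k3.1], by linarith only [k3.2]⟩
  · obtain ⟨e1, e0, e1', e0'⟩ := dLoHi_neg_zero 1 (R.aLo j - R.ea - R.La) (R.aHi j + R.ea + R.La) (R.bLo j - R.eb - R.Lb) (R.bHi j + R.eb + R.Lb)
    rw [oth_one'] at e0 e0'
    set lo' := dLo 1 (-1) 0 (R.aLo j - R.ea - R.La) (R.aHi j + R.ea + R.La) (R.bLo j - R.eb - R.Lb) (R.bHi j + R.eb + R.Lb) with hlo'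
    set hi' := dHi 1 (-1) 0 (R.aLo j - R.ea - R.La) (R.aHi j + R.ea + R.La) (R.bLo j - R.eb - R.Lb) (R.bHi j + R.eb + R.Lb) with hhi'
    have k1 := readHi1_of_budgetK (A := A) (c₀' := c₀') (D := D) hD hm hkq hsc1 hr40 (lo := lo') (hi := hi') (m := 5) (B := Bm) (by rw [e1']; linarith) hby1
    have k2 := readLo1_of_budgetK (A := A) (c₀' := c₀') (D := D) hD hm hkq hsc1 hr40 (lo := lo') (hi := hi') (m := 22) (B := Bp) (by rw [e1]; linarith) hby2'
    have hanch := anchor_leK hn ℓ hΔlo hΔhi hkq (Or.inr rfl : (-1 : ℤ) = 1 ∨ (-1 : ℤ) = -1) hj8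
    have k3 := readAcross0_driftK (c₁' := c₁') hn hA hD hm hc₀ hkq hsc0 (lo := lo') (hi := hi') (t := -1 * j) (B := B0) (c := -1 * j * Q) (ρ := ρ)
      (E := 800 * (kq : ℤ) * (n + (shearUnit n h : ℤ))) (Y := 2 * (P.r 0 : ℤ))
      (by rw [e0]; linarith) (by rw [e0']; linarith)
      (by rw [e1, show -(R.aHi j + ↑R.ea + ↑R.La) - -1 * ↑j * Q = -(R.aHi j + ↑R.ea + ↑R.La - ↑j * Q) by ring, abs_neg]; exact dHi')
      (by rw [e1', show -(R.aLo j - ↑R.ea - ↑R.La) - -1 * ↑j * Q = -(R.aLo j - ↑R.ea - ↑R.La - ↑j * Q) by ring, abs_neg]; exact dLo') hanch hby3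
    exact ⟨fun h1 => absurd h1 (by norm_num), fun _ => ⟨by linarith only [k1], by linarith only [k2]⟩, by linarith only [k3.1], by linarith only [k3.2]⟩

/-! ## §3 The last core of the y′-band: the arrival box `cen' ± (b₀ − 1)` -/

set_option maxHeartbeats 400000 in
/-- **The last core (`j = 800kq`) of the y′-band reads inside the next cell's arrival box with one unit of margin**, either sign, under the
target floors `hyL1` (`40kqΔ·(20r₁ − b₀ + 1) + r₁·(U − 1) < r₁·U·(800kq·sA − q_y − 800kq·T)`), `hyL2` (`r₁·(U·(800kq·W_B + q_y + 800kq·T) + U − 1) <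
40kqΔ·(20r₁ + b₀ − 1)`) and `hyL3` (the drifting-box budget with `B := Wmy + Wpy + 800kq·T`, `ρ := 2400kq + q_y + 800kq·T`, `E := 800kq·(n + U)`,
`Y := b₀⊥`). [cite: KozmaNitzan2024, §4 Lemma 12 (pp. 23–25), p. 26 (M_v)] -/
theorem roomsLyK (hn : 1 ≤ n) (hA : 0 < A) (hD : 0 < D) (hm : 0 < modulus n h v vβ) (hc₀ : 0 < c₀') (hkq : 1 ≤ kq)
    (hsc0 : c₀' * A * (40 * (kq : ℤ) * modulus n h v vβ) = (P.r 0 : ℤ) * D) (hsc1 : c₁' * A * (40 * (kq : ℤ) * modulus n h v vβ) = (P.r 1 : ℤ) * D)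
    (hΔlo : (n : ℤ) * ℓ - n < modulus n h v vβ) (hΔhi : modulus n h v vβ ≤ (n : ℤ) * ℓ) (b₀ : Fin 2 → ℕ)
    (hyL1 : 40 * (kq : ℤ) * modulus n h v vβ * (20 * (P.r 1 : ℤ) - (b₀ 1 : ℕ) + 1) + (P.r 1 : ℤ) * ((shearUnit n h : ℤ) - 1) <
      (P.r 1 : ℤ) * ((shearUnit n h : ℤ) * (800 * (kq : ℤ) * sA n ℓ h - (qy n ℓ h v T aW bL : ℕ) - 800 * (kq : ℤ) * T)))
    (hyL2 : (P.r 1 : ℤ) * ((shearUnit n h : ℤ) * (800 * (kq : ℤ) * ((Qw n ℓ h : ℕ) : ℤ) + (qy n ℓ h v T aW bL : ℕ) + 800 * (kq : ℤ) * T) + shearUnit n h - 1) <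
      40 * (kq : ℤ) * modulus n h v vβ * (20 * (P.r 1 : ℤ) + (b₀ 1 : ℕ) - 1))
    (hyL3 : (P.r 0 : ℤ) * (modulus n h v vβ * (((Wmy n v : ℕ) : ℤ) + (Wpy n v : ℕ) + 800 * (kq : ℤ) * T) +
        |v| * ((shearUnit n h : ℤ) * ((2400 * (kq : ℤ) + ((qy n ℓ h v T aW bL : ℕ) : ℤ) + 800 * (kq : ℤ) * T) + 1)) + |v| * (800 * (kq : ℤ) * (n + (shearUnit n h : ℤ)))) +
        40 * (kq : ℤ) * modulus n h v vβ * n + (P.r 0 : ℤ) * n ≤ 40 * (kq : ℤ) * modulus n h v vβ * (n * ((b₀ 0 : ℕ) : ℤ)))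
    {du : MDir} (hd : du.1 = 1) :
    let Bd := bandNw n ℓ h v T n (800 * kq - 1) (qy n ℓ h v T aW bL) (800 * kq - 1) (qy n ℓ h v T aW bL) (Wmy n v) (Wpy n v) du
    let lo := dLo du.1 (sgOf du) 0 (Bd.aLo (Bd.N + 1)) (Bd.aHi (Bd.N + 1)) (Bd.bLo (Bd.N + 1)) (Bd.bHi (Bd.N + 1))
    let hi := dHi du.1 (sgOf du) 0 (Bd.aLo (Bd.N + 1)) (Bd.aHi (Bd.N + 1)) (Bd.bLo (Bd.N + 1)) (Bd.bHi (Bd.N + 1))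
    (sgOf du = 1 → 20 * (P.r du.1 : ℤ) - (b₀ du.1 : ℕ) + 1 ≤ rdLo A n h v vβ c₀' c₁' D lo hi du.1 ∧
      rdHi A n h v vβ c₀' c₁' D lo hi du.1 ≤ 20 * (P.r du.1 : ℤ) + (b₀ du.1 : ℕ) - 1) ∧
    (sgOf du = -1 → 20 * (P.r du.1 : ℤ) - (b₀ du.1 : ℕ) + 1 ≤ -rdHi A n h v vβ c₀' c₁' D lo hi du.1 ∧
      -rdLo A n h v vβ c₀' c₁' D lo hi du.1 ≤ 20 * (P.r du.1 : ℤ) + (b₀ du.1 : ℕ) - 1) ∧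
    (-((b₀ (oth du.1) : ℕ) : ℤ) + 1 ≤ rdLo A n h v vβ c₀' c₁' D lo hi (oth du.1) ∧
      rdHi A n h v vβ c₀' c₁' D lo hi (oth du.1) ≤ ((b₀ (oth du.1) : ℕ) : ℤ) - 1) := by
  intro Bd lo hi
  dsimp only [Bd, lo, hi]
  rw [bandNw_yK (n := n) (ℓ := ℓ) (h := h) (v := v) (T := T) (aW := aW) (bL := bL) hd, hd, oth_one']
  obtain ⟨haLo, haHi, hbLo, hbHi, -, -, -, -, hN⟩ := cornersYK (kq := kq) (n := n) (h := h) (v := v) (ℓ := ℓ) (T := T) (aW := aW) (bL := bL) (800 * kq)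
  set R := yPrmXw n ℓ h v T (qy n ℓ h v T aW bL) (800 * kq - 1) (Wmy n v) (Wpy n v) with hR
  rw [hN, NCk_spec hkq]
  have hQ : ((Qw n ℓ h : ℕ) : ℤ) = (n : ℤ) * ℓ / (shearUnit n h : ℕ) + 1 := by unfold Qw; push_cast; rfl
  rw [← hQ] at haHi
  obtain ⟨hs1, hs2⟩ := sA_bounds hn ℓ h
  set Q : ℤ := ((Qw n ℓ h : ℕ) : ℤ) with hQdef
  set qY : ℤ := ((qy n ℓ h v T aW bL : ℕ) : ℤ) with hqY
  set B0 : ℤ := ((Wmy n v : ℕ) : ℤ) + (Wpy n v : ℕ) + 800 * (kq : ℤ) * T with hB0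
  set ρ : ℤ := 2400 * (kq : ℤ) + qY + 800 * (kq : ℤ) * T with hρ
  have hΔ : (0 : ℤ) < modulus n h v vβ := hm
  have hT0 : (0 : ℤ) ≤ T := by positivity
  have hq0 : (0 : ℤ) ≤ qY := by positivity
  have hU : (0 : ℤ) ≤ (shearUnit n h : ℤ) := by positivity
  have hU1 : (1 : ℤ) ≤ (shearUnit n h : ℤ) := by
    have : 1 ≤ shearUnit n h := by unfold shearUnit; omega
    exact_mod_cast this
  have hr1 : (1 : ℤ) ≤ P.r 1 := by exact_mod_cast P.one_le_r 1
  have hWm0 : (0 : ℤ) ≤ ((Wmy n v : ℕ) : ℤ) := by positivity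
  have hWp0 : (0 : ℤ) ≤ ((Wpy n v : ℕ) : ℤ) := by positivity
  -- the corners of the last core
  have cLo : R.aLo (800 * kq) = 800 * (kq : ℤ) * sA n ℓ h - qY - 800 * (kq : ℤ) * T := by rw [haLo]; push_cast; ring
  have cHi : R.aHi (800 * kq) = 800 * (kq : ℤ) * Q + qY + 800 * (kq : ℤ) * T := by rw [haHi]; push_cast; ring
  have cbL : R.bLo (800 * kq) = v * (800 * (kq : ℤ)) - (((Wmy n v : ℕ) : ℤ) + 800 * (kq : ℤ) * T) := by rw [hbLo]; push_cast; ring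
  have cbH : R.bHi (800 * kq) = v * (800 * (kq : ℤ)) + (((Wpy n v : ℕ) : ℤ) + 800 * (kq : ℤ) * T) := by rw [hbHi]; push_cast; ring
  have hk0 : (0 : ℤ) ≤ 800 * (kq : ℤ) := by positivity
  have hQs1 : 800 * (kq : ℤ) * (Q - sA n ℓ h) ≤ 800 * (kq : ℤ) * 3 := mul_le_mul_of_nonneg_left (by linarith) hk0
  have hQs0 : 0 ≤ 800 * (kq : ℤ) * (Q - sA n ℓ h) := mul_nonneg hk0 (by linarith)
  have hkT0 : 0 ≤ 800 * (kq : ℤ) * T := mul_nonneg hk0 hT0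
  have dLo' : |R.aLo (800 * kq) - 800 * (kq : ℤ) * Q| ≤ ρ := by
    rw [cLo, abs_le]
    have e : 800 * (kq : ℤ) * sA n ℓ h - qY - 800 * (kq : ℤ) * ↑T - 800 * (kq : ℤ) * Q = -(800 * (kq : ℤ) * (Q - sA n ℓ h)) - qY - 800 * (kq : ℤ) * ↑T := by ring
    rw [e]; constructor <;> linarith
  have dHi' : |R.aHi (800 * kq) - 800 * (kq : ℤ) * Q| ≤ ρ := by
    rw [cHi, abs_le]; constructor <;> linarith
  rcases sgOf_sign du with hs | hs <;> rw [hs]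
  · obtain ⟨e1, e0, e1', e0'⟩ := dLoHi_one_zero 1 (R.aLo (800 * kq)) (R.aHi (800 * kq)) (R.bLo (800 * kq)) (R.bHi (800 * kq))
    rw [oth_one'] at e0 e0'
    set lo' := dLo 1 1 0 (R.aLo (800 * kq)) (R.aHi (800 * kq)) (R.bLo (800 * kq)) (R.bHi (800 * kq)) with hlo'
    set hi' := dHi 1 1 0 (R.aLo (800 * kq)) (R.aHi (800 * kq)) (R.bLo (800 * kq)) (R.bHi (800 * kq)) with hhi'
    have hanch := anchor_leK hn ℓ hΔlo hΔhi hkq (Or.inl rfl : (1 : ℤ) = 1 ∨ (1 : ℤ) = -1) (le_refl (800 * kq))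
    have k3 := readAcross0_driftK (c₁' := c₁') hn hA hD hm hc₀ hkq hsc0 (lo := lo') (hi := hi') (t := 1 * ((800 * kq : ℕ) : ℤ)) (B := B0) (c := 1 * ((800 * kq : ℕ) : ℤ) * Q)
      (ρ := ρ) (E := 800 * (kq : ℤ) * (n + (shearUnit n h : ℤ))) (Y := ((b₀ 0 : ℕ) : ℤ))
      (by rw [e0, cbL]; push_cast; linarith) (by rw [e0', cbH]; push_cast; linarith)
      (by rw [e1, show (1 : ℤ) * ((800 * kq : ℕ) : ℤ) * Q = 800 * (kq : ℤ) * Q by push_cast; ring]; exact dLo')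
      (by rw [e1', show (1 : ℤ) * ((800 * kq : ℕ) : ℤ) * Q = 800 * (kq : ℤ) * Q by push_cast; ring]; exact dHi') hanch hyL3
    refine ⟨fun _ => ⟨?_, ?_⟩, fun h1 => absurd h1 (by norm_num), k3.1, k3.2⟩
    · refine rdLo_one_geK hD hm hkq hsc1 ?_
      rw [e1, cLo]
      have h0 : (0 : ℤ) ≤ (P.r 1 : ℤ) * ((shearUnit n h : ℤ) - 1) := mul_nonneg (by linarith) (by linarith)
      linarith [hyL1]
    · refine rdHi_one_leK hD hm hkq hsc1 ?_
      rw [e1', cHi]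
      linarith [hyL2]
  · obtain ⟨e1, e0, e1', e0'⟩ := dLoHi_neg_zero 1 (R.aLo (800 * kq)) (R.aHi (800 * kq)) (R.bLo (800 * kq)) (R.bHi (800 * kq))
    rw [oth_one'] at e0 e0'
    set lo' := dLo 1 (-1) 0 (R.aLo (800 * kq)) (R.aHi (800 * kq)) (R.bLo (800 * kq)) (R.bHi (800 * kq)) with hlo'
    set hi' := dHi 1 (-1) 0 (R.aLo (800 * kq)) (R.aHi (800 * kq)) (R.bLo (800 * kq)) (R.bHi (800 * kq)) with hhi'
    have hanch := anchor_leK hn ℓ hΔlo hΔhi hkq (Or.inr rfl : (-1 : ℤ) = 1 ∨ (-1 : ℤ) = -1) (le_refl (800 * kq))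
    have k3 := readAcross0_driftK (c₁' := c₁') hn hA hD hm hc₀ hkq hsc0 (lo := lo') (hi := hi') (t := -1 * ((800 * kq : ℕ) : ℤ)) (B := B0) (c := -1 * ((800 * kq : ℕ) : ℤ) * Q)
      (ρ := ρ) (E := 800 * (kq : ℤ) * (n + (shearUnit n h : ℤ))) (Y := ((b₀ 0 : ℕ) : ℤ))
      (by rw [e0, cbH]; push_cast; linarith) (by rw [e0', cbL]; push_cast; linarith)
      (by rw [e1, show -R.aHi (800 * kq) - -1 * ((800 * kq : ℕ) : ℤ) * Q = -(R.aHi (800 * kq) - 800 * (kq : ℤ) * Q) by push_cast; ring, abs_neg]; exact dHi')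
      (by rw [e1', show -R.aLo (800 * kq) - -1 * ((800 * kq : ℕ) : ℤ) * Q = -(R.aLo (800 * kq) - 800 * (kq : ℤ) * Q) by push_cast; ring, abs_neg]; exact dLo') hanch hyL3
    refine ⟨fun h1 => absurd h1 (by norm_num), fun _ => ⟨?_, ?_⟩, k3.1, k3.2⟩
    · suffices hh : rdHi A n h v vβ c₀' c₁' D lo' hi' 1 ≤ -(20 * (P.r 1 : ℤ) - (b₀ 1 : ℕ) + 1) by linarith
      refine rdHi_one_leK hD hm hkq hsc1 ?_
      rw [e1', cLo]
      linarith [hyL1]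
    · suffices hh : -(20 * (P.r 1 : ℤ) + (b₀ 1 : ℕ) - 1) ≤ rdLo A n h v vβ c₀' c₁' D lo' hi' 1 by linarith
      refine rdLo_one_geK hD hm hkq hsc1 ?_
      rw [e1, cHi]
      have h0 : (0 : ℤ) ≤ (P.r 1 : ℤ) * ((shearUnit n h : ℤ) - 1) := mul_nonneg (by linarith) (by linarith)
      linarith [hyL2]


end YBand

end CorrRec

end Skelφ

end Transplant

end Summit.CriticalPhenomena.PercolationContinuityZ3.Theorems

end
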